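import Summits.ResolutionOfSingularities.ResolutionOfSingularities.Theses.RadicialJung
import Summits.ResolutionOfSingularities.ResolutionOfSingularities.Theorems.RadicialJungCleanModelsClosedPoints
import Summits.ResolutionOfSingularities.ResolutionOfSingularities.Theorems.RadicialJungCleanModelsDimTwoFFinite
import Literature.AlgebraicGeometry.Resolution.GiraudFunctionNormalForm
import HarnessLib

/-!
# Route `RadicialJung`, crux `CleanModels`: the crux HOLDS IN DIMENSION 2 OVER `F`-FINITE FIELDS,
# conditionally on Giraud 1983 (line `Sketch` rev 10)

Route `ResolutionOfSingularities/RadicialJung`, crux item `CleanModels`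
(stmt-ResolutionOfSingularities-15917), line `Sketch` rev 10 (lead c2, 2026-08-17).

`CleanModels` asks, for `W` regular integral separated of finite type over a field `k` of
characteristic `p` and `L/K(W)` purely inseparable of degree `p`, for a proper birational REGULAR
model `V → W` on which at every point some generator `y`, `y^p = g`, has `π^* g` EXACTLY
log-clean with respect to an ALGEBRAIC minimal generating system of `𝔪_v`. This file records the
outcome of the line's dimension-2 cut:

* `cleanModels_dimTwo_FFinite_of_giraud1983` — **granted Giraud's theorem**
  (`Literature.AlgebraicGeometry.Resolution.Giraud1983Thm24`: Giraud, Bull. SMF 111 (1983),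
  Thm. 2.4 with Prop. 1.5 (ii) — after finitely many closed-point blow-ups of a regular surface
  with `Ω¹` of finite rank a global function `f ∉ K^p` is Zariski-locally
  `g^p + u ∏ x_i^{a_i}` with `(x_i)` part of a regular system of parameters and (c-1) some `a_i`
  prime to `p`, `u` a unit, or (c-2) `(x, u)` differentially free), **the body of `CleanModels`
  holds for every `W` of dimension `2` over an `F`-finite field `k`** (`IsFFinite p 1 k`:
  `[k : k^p] < ∞` — every perfect field, every finitely generated field, `𝔽_p((t))`, …).

Proof: a generator `y₀`, `y₀^p = g₀ ∉ K(W)^p` (`stub_generator`); the conditional loosely clean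
principalization at closed points `principalizationDimTwoFFinite_of_giraud`
(Theorems/RadicialJungCleanModelsDimTwoFFinite.lean: induction over a finite affine cover —
affine avoidance, Giraud's theorem on an affine chart where `b^p g₀` is a global function, read
as loose cleanness by `stub_looseCleanOfGiraud15`, patched in by the push-out
`stub_glueLocalModification`); the representative `Σ c_j^p g₀^j` read as `y^p`
(`stub_frobeniusTwist`); generisation to all points and the pointwise passage from loose to exact
forms (`looseCleanAll_of_closedPoints`, `cleanModels_of_looseCleanAll`, landed rev 5–9).

So in dimension 2 over `F`-finite fields the crux rests on ONE printed theorem (formalization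
debt, not an open problem), with NO formal/étale detour and NO extra "Zariski upgrade": the
route's recorded risk "algebraic `t_i` may cost extra blow-ups or fail" does not materialise in
dimension 2, because Giraud's Prop. 1.5 (ii) is already Zariski-local with algebraic parameters.
What remains open of the crux is `dim W ≥ 3` (Cossart 1987 in completions for `dim 3`, `k = k̄`;
OPEN `dim ≥ 4`) and `dim W = 2` over non-`F`-finite fields.
-/

noncomputable section

set_option linter.dupNamespace false -- mandated namespace of this single-conjunct summit

open CategoryTheory AlgebraicGeometry TopologicalSpace IsLocalRing
open Literature.AlgebraicGeometry.Resolution Literature.AlgebraicGeometry.Motives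

namespace Summit.ResolutionOfSingularities.ResolutionOfSingularities.Theorems.RadicialJung.CleanModels

/-- **`CleanModels` in dimension 2 over an `F`-finite field, granted Giraud 1983 (Thm. 2.4 with
Prop. 1.5).** Let `k` be an `F`-finite field of characteristic `p`, `W` a regular integral
separated scheme of finite type over `k` with `dim W = 2` (`¬ dim W ≤ 1`, `dim W ≤ 2`), and
`L/K(W)` purely inseparable of degree `p`. If Giraud's theorem `Giraud1983Thm24` holds, then
there are an integral `V` and a proper birational dominant `π : V → W` with `V` regular such that
at EVERY point `v ∈ V` some `y ∈ L ∖ K(W)`, `y^p = g`, has `π^* g` exactly clean: toroidal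
`∏_{i<m} t_i^{a_i}` along a minimal generating system of `𝔪_v` with all `p ∤ a_i`, or a unit
`u₀` with `(∀ c, u₀ - c^p ∉ 𝔪_v) ∨ (∃ c, u₀ - c^p ∈ 𝔪_v ∖ 𝔪_v²)`.
[cite: Giraud1983, Thm. 2.4 and Prop. 1.5] -/
theorem cleanModels_dimTwo_FFinite_of_giraud1983 (hG : Giraud1983Thm24) (p : ℕ) (hp : p.Prime)
    (k : Type) [Field k] [CharP k p] (hk : IsFFinite p 1 k) (W : Scheme.{0}) [IsIntegral W]
    (f : W ⟶ Spec (.of k)) [IsSeparated f] [LocallyOfFiniteType f] [QuasiCompact f]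
    (hW : Scheme.IsRegular W) (L : Type) [Field L] [Algebra W.functionField L]
    [IsPurelyInseparable W.functionField L] (hdeg : Module.finrank W.functionField L = p)
    (hdim₁ : ¬ topologicalKrullDim W ≤ 1) (hdim₂ : topologicalKrullDim W ≤ 2) :
    ∃ (V : Scheme.{0}) (π : V ⟶ W) (_ : IsIntegral V) (_ : IsDominant π),
      IsProper π ∧ IsBirational π ∧ Scheme.IsRegular V ∧
      (∀ v : V, (∃ (y : L) (g : W.functionField), y ∉ Set.range (algebraMap W.functionField L) ∧
        algebraMap W.functionField L g = y ^ p ∧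
        ((∃ (d m : ℕ) (hmd : m ≤ d) (t : Fin d → V.presheaf.stalk v) (a : Fin m → ℕ),
            Ideal.span (Set.range t) = maximalIdeal (V.presheaf.stalk v) ∧
            ringKrullDim (V.presheaf.stalk v) = (d : WithBot ℕ∞) ∧ 0 < m ∧ (∀ i, ¬ p ∣ a i) ∧
            RatFn.functionFieldMap π g = ∏ i : Fin m,
              (algebraMap (V.presheaf.stalk v) V.functionField (t (Fin.castLE hmd i))) ^ (a i)) ∨
          (∃ u₀ : V.presheaf.stalk v, IsUnit u₀ ∧
            RatFn.functionFieldMap π g = algebraMap (V.presheaf.stalk v) V.functionField u₀ ∧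
            ((∀ c : V.presheaf.stalk v, u₀ - c ^ p ∉ maximalIdeal (V.presheaf.stalk v)) ∨
              (∃ c : V.presheaf.stalk v, u₀ - c ^ p ∈ maximalIdeal (V.presheaf.stalk v) ∧
                u₀ - c ^ p ∉ maximalIdeal (V.presheaf.stalk v) ^ 2)))))) := by
  haveI : Fact p.Prime := ⟨hp⟩
  haveI : CharP W.functionField p := charP_stalk W f _
  -- a generator `y₀`, `y₀^p = g₀ ∉ K(W)^p`
  obtain ⟨-, y₀, g₀, hy₀, hg₀, hg₀p⟩ := stub_generator (K := W.functionField) (L := L) p hp hdeg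
  -- the loosely clean principalization at closed points, from Giraud's theorem
  obtain ⟨V', π', hV'int, hπ'dom, hπ'prop, hπ'bir, hV'reg, halg⟩ :=
    principalizationDimTwoFFinite_of_giraud p k hk hG W f hW
      (topologicalKrullDim_eq_two_of hdim₁ hdim₂) g₀ hg₀p
  haveI := hV'int; haveI := hπ'dom; haveI := hπ'prop
  -- loosely clean at closed points, read in `L`
  have hclosed : ∀ v : V', IsClosed ({v} : Set V') → ∃ (y : L) (g : W.functionField),
      y ∉ Set.range (algebraMap W.functionField L) ∧ algebraMap W.functionField L g = y ^ p ∧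
      ((∃ (d m : ℕ) (hmd : m ≤ d) (t : Fin d → V'.presheaf.stalk v) (a : Fin m → ℕ)
          (u : V'.presheaf.stalk v), IsUnit u ∧
          Ideal.span (Set.range t) = maximalIdeal (V'.presheaf.stalk v) ∧
          ringKrullDim (V'.presheaf.stalk v) = (d : WithBot ℕ∞) ∧ 0 < m ∧ (∀ i, ¬ p ∣ a i) ∧
          RatFn.functionFieldMap π' g = algebraMap (V'.presheaf.stalk v) V'.functionField
            (u * ∏ i : Fin m, t (Fin.castLE hmd i) ^ (a i))) ∨
        (∃ u : V'.presheaf.stalk v, IsUnit u ∧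
          RatFn.functionFieldMap π' g = algebraMap (V'.presheaf.stalk v) V'.functionField u ∧
          ∀ c : V'.presheaf.stalk v, u - c ^ p ∉ maximalIdeal (V'.presheaf.stalk v)) ∨
        (∃ s c : V'.presheaf.stalk v,
          RatFn.functionFieldMap π' g = algebraMap (V'.presheaf.stalk v) V'.functionField s ∧
          s - c ^ p ∈ maximalIdeal (V'.presheaf.stalk v) ∧
          s - c ^ p ∉ maximalIdeal (V'.presheaf.stalk v) ^ 2)) := by
    intro v hv
    obtain ⟨c, ⟨j₀, hj₀, hc⟩, hloose⟩ := halg v hv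
    obtain ⟨y, hy, hyp⟩ := stub_frobeniusTwist (K := W.functionField) (L := L) p hp y₀ g₀ hy₀ hg₀
      c j₀ hj₀ hc 1 one_ne_zero 0 (Nat.zero_le 1)
    refine ⟨y, ∑ j : Fin p, c j ^ p * g₀ ^ (j : ℕ), hy, ?_, hloose⟩
    rw [one_pow, one_mul, Nat.cast_zero, add_zero] at hyp
    exact hyp
  refine ⟨V', π', hV'int, hπ'dom, hπ'prop, hπ'bir, hV'reg, fun v => ?_⟩
  exact cleanModels_of_looseCleanAll p hp k W f L V' π' hπ'bir
    (looseCleanAll_of_closedPoints p hp k W f L V' π' hπ'bir hV'reg hclosed) v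

end Summit.ResolutionOfSingularities.ResolutionOfSingularities.Theorems.RadicialJung.CleanModels

end
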